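import Literature.Analysis.FluidPDE.CylindricalGenerator
import Literature.Analysis.FluidPDE.StatisticalSolutionDirac
import HarnessLib

/-! # Stub `stub_testEnstrophyTame` of line `Sketch` (crux stmt-AnomalousDissipation-15510, `EnsembleRigidity.ResidualTransferSSS`)

**The test enstrophy `u ↦ ‖∇Φ'(u)‖²` of a cylindrical test functional is continuous and bounded
on `H`.** For a cylindrical test functional `Φ(u) = φ((u,g₁),…,(u,gₘ))` on the energy space
`H = Torus.energySpace d` (Foias–Manley–Rosa–Temam 2001, Ch. IV §1.2, Def. 1.2 and the example
after (1.27)) the differential is the finite combination `Φ'(u) = ∑ᵢ cᵢ(u) gᵢ` of the smooth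
test fields with the coefficients `cᵢ(u) = ∂ᵢφ(coords u)`, which are continuous
(`Torus.CylindricalTest.continuous_fderiv_coords`, `φ ∈ C¹`) and bounded
(`Torus.CylindricalTest.exists_abs_fderiv_coords_le`, `φ ∈ C¹_c`) on `H`. The Gram expansion

  `‖∇(∑ᵢ cᵢ gᵢ)‖₂² = ∑ᵢ ∑ⱼ cᵢ cⱼ ∫ ∑ₗ ⟪∂ₗ gᵢ, ∂ₗ gⱼ⟫`        (`gradNormSq_sum_smul_eq_gram`)

(`∂ₗ` is linear over finite combinations of smooth fields, `Torus.partialDeriv_finset_sum_smul`;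
each Gram entry is the integral of a continuous function on the compact torus) then exhibits
`u ↦ gradNormSq (Φ.grad u)` as a finite sum of products of bounded continuous functions with
constants (`stub_testEnstrophyTame`). This is what makes `∫ ‖∇Φ'(u)‖² dμ(u)` an honest Bochner
integral against a (probability) statistical solution `μ` in the crux `ResidualTransferSSS`.

Pattern adapted from the tree's `gradNormSq_sum_smul`
(`Summits/AnomalousDissipation/AnomalousDissipation/Theorems/MomentParityQuarticGateEnstrophy.lean`,
there on `T³` with `Fin n` coefficients), here for a general torus `T^d` and index type.

## References

* C. Foias, O. Manley, R. Rosa, R. Temam, *Navier–Stokes Equations and Turbulence* (CUP 2001),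
  Ch. IV §1.2, Def. 1.2 and the display after (1.27) (`Φ'(u) = ∑ⱼ ∂ⱼψ gⱼ`). [FoiasManleyRosaTemam2001]
-/

-- `Summit.<Summit>.<Problem>` is the tree's mandated summit-side namespace (CONVENTIONS §2); single-conjunct summit, duplicate deliberate.
set_option linter.dupNamespace false

noncomputable section

namespace Summit.AnomalousDissipation.AnomalousDissipation.Theorems.ResidualTransferSSS

open MeasureTheory Filter Topology UnitAddTorus
open scoped InnerProductSpace RealInnerProductSpace ENNReal NNReal
open Literature.Analysis.FunctionSpaces Literature.Analysis.FluidPDE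

variable {d : Type*} [Fintype d] [DecidableEq d]

/-- **Gram expansion of the enstrophy of a finite combination of smooth fields**:
`‖∇(∑ᵢ cᵢ bᵢ)‖₂² = ∑ᵢ ∑ⱼ cᵢ cⱼ ∫ ∑ₗ ⟪∂ₗ bᵢ, ∂ₗ bⱼ⟫` (linearity of `∂ₗ`, bilinearity of the inner
product, and `∫ ∑ = ∑ ∫` for the continuous — hence integrable — Gram integrands on the compact
torus). [folklore] -/
theorem gradNormSq_sum_smul_eq_gram {ι : Type*} [Fintype ι]
    {b : ι → UnitAddTorus d → EuclideanSpace ℝ d} (hb : ∀ i, Torus.IsSmooth (b i)) (c : ι → ℝ) :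
    Torus.gradNormSq (fun z => ∑ i, c i • b i z) =
      ∑ i, ∑ i', c i * c i' *
        ∫ y, ∑ j, ⟪Torus.partialDeriv j (b i) y, Torus.partialDeriv j (b i') y⟫_ℝ := by
  have hcont : ∀ i i', Continuous fun y => ∑ j : d,
      ⟪Torus.partialDeriv j (b i) y, Torus.partialDeriv j (b i') y⟫_ℝ := fun i i' =>
    continuous_finsetSum _ fun j _ =>
      ((hb i).partialDeriv j).continuous.inner ((hb i').partialDeriv j).continuous
  have hint : ∀ i i', Integrable (fun y => ∑ j : d,
      ⟪Torus.partialDeriv j (b i) y, Torus.partialDeriv j (b i') y⟫_ℝ) volume := fun i i' =>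
    (hcont i i').integrable_unitAddTorus
  -- pointwise expansion of the integrand
  have hpt : ∀ y, ∑ j, ‖Torus.partialDeriv j (fun z => ∑ i, c i • b i z) y‖ ^ 2 =
      ∑ i, ∑ i', c i * c i' *
        ∑ j, ⟪Torus.partialDeriv j (b i) y, Torus.partialDeriv j (b i') y⟫_ℝ := by
    intro y
    simp_rw [Torus.partialDeriv_finset_sum_smul Finset.univ c hb, ← real_inner_self_eq_norm_sq,
      sum_inner, inner_sum, real_inner_smul_left, real_inner_smul_right, Finset.mul_sum]
    rw [Finset.sum_comm]
    refine Finset.sum_congr rfl fun i _ => ?_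
    rw [Finset.sum_comm]
    refine Finset.sum_congr rfl fun i' _ => Finset.sum_congr rfl fun j _ => ?_
    ring
  unfold Torus.gradNormSq
  simp_rw [hpt]
  rw [integral_finsetSum _ fun i _ => integrable_finsetSum _ fun i' _ => (hint i i').const_mul _]
  refine Finset.sum_congr rfl fun i _ => ?_
  rw [integral_finsetSum _ fun i' _ => (hint i i').const_mul _]
  refine Finset.sum_congr rfl fun i' _ => ?_
  exact integral_const_mul _ _

/-- **The test enstrophy `v ↦ ‖∇Φ'(v)‖²` is continuous and bounded on `H`**: `Φ'(v) = ∑ᵢ cᵢ(v) gᵢ`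
with bounded continuous coefficients `cᵢ(v) = ∂ᵢφ(coords v)` (`φ ∈ C¹_c`), so
`‖∇Φ'(v)‖² = ∑ᵢⱼ cᵢ(v) cⱼ(v) ∫ ∑ₗ ⟪∂ₗgᵢ, ∂ₗgⱼ⟫`. [folklore] -/
theorem stub_testEnstrophyTame (Φ : Torus.CylindricalTest d) :
    Continuous (fun u : Torus.energySpace d => Torus.gradNormSq (Φ.grad u)) ∧
      ∃ C : ℝ, ∀ u : Torus.energySpace d, Torus.gradNormSq (Φ.grad u) ≤ C := by
  -- the Gram matrix of the test fields
  set A : Fin Φ.m → Fin Φ.m → ℝ := fun i i' =>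
    ∫ y, ∑ j, ⟪Torus.partialDeriv j (Φ.g i) y, Torus.partialDeriv j (Φ.g i') y⟫_ℝ
  have hexp : ∀ u : Torus.energySpace d, Torus.gradNormSq (Φ.grad u) =
      ∑ i, ∑ i', fderiv ℝ Φ.φ (Φ.coords u) (EuclideanSpace.single i 1) *
        fderiv ℝ Φ.φ (Φ.coords u) (EuclideanSpace.single i' 1) * A i i' := fun u =>
    gradNormSq_sum_smul_eq_gram Φ.g_smooth _
  have hfun : (fun u : Torus.energySpace d => Torus.gradNormSq (Φ.grad u)) = fun u =>
      ∑ i, ∑ i', fderiv ℝ Φ.φ (Φ.coords u) (EuclideanSpace.single i 1) *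
        fderiv ℝ Φ.φ (Φ.coords u) (EuclideanSpace.single i' 1) * A i i' := funext hexp
  refine ⟨?_, ?_⟩
  · rw [hfun]
    exact continuous_finsetSum _ fun i _ => continuous_finsetSum _ fun i' _ =>
      ((Φ.continuous_fderiv_coords i).mul (Φ.continuous_fderiv_coords i')).mul continuous_const
  · obtain ⟨M, hM0, hM⟩ := Φ.exists_abs_fderiv_coords_le
    refine ⟨∑ i : Fin Φ.m, ∑ i' : Fin Φ.m, M * M * |A i i'|, fun u => ?_⟩
    rw [hexp u]
    refine Finset.sum_le_sum fun i _ => Finset.sum_le_sum fun i' _ => ?_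
    refine (le_abs_self _).trans ?_
    rw [abs_mul, abs_mul]
    exact mul_le_mul (mul_le_mul (hM u i) (hM u i') (abs_nonneg _) hM0) le_rfl (abs_nonneg _)
      (mul_nonneg hM0 hM0)

end Summit.AnomalousDissipation.AnomalousDissipation.Theorems.ResidualTransferSSS

end
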